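import Mathlib
import HarnessLib
import Summits.Langlands.Langlands.Theses.ParityBlindBianchi
import Summits.Langlands.Langlands.Theses.RuelleTorsionArtinWeight
import Summits.Langlands.Langlands.Theorems.ParityBlindBianchiArtinWeightRealisationLevelCuspFormsDischarged
import Literature.NumberTheory.Automorphic.PiOfArtinRepChevalleyProofs
import Literature.NumberTheory.NumberFields.ChevalleyVUnitCongruenceProofs

/-!
# `ArtinWeightRealisationLevel` (R′, crux stmt-Langlands-15111) modulo item stmt-Langlands-11057 and
# the twisted Hecke theory of `GL(2)` alone

Helper file of line `Sketch` (continuation lead c8), `--supports stmt-Langlands-15111`.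

State of the art in the tree (2026-08-16T18:00Z).  The crux R′ was closed modulo the shared a.e. crux
R (`RuelleTorsionArtinWeight.ArtinWeightRealisation`, item stmt-Langlands-11057) and Gelbart's
Prop. 4.1 σ-unramified shadow hG (`frobSatakeCompatibleAt_of_isPiOfArtinRep_of_isUnramifiedAt`) by
`artinWeightRealisationLevel_of_artinWeightRealisation_of_gelbart` (`…CuspFormsDischarged`), and
`R′ → R` is unconditional (`…SharedOfLevel`).  Meanwhile the Literature programme on hG has formalized
everything in Jacquet–Langlands' proof of Thm. 12.2 / Cor. 11.2 for `π = π(σ)` except the Hecke theory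
of `GL(2)` itself: `frobSatakeCompatibleAt_of_isPiOfArtinRep_both_of_chevalley`
(`Automorphic/PiOfArtinRepChevalleyProofs`: `Chev → HT → both shadows`), with Chevalley's congruence
theorem `Chev` now the tree theorem `NumberFields.Chevalley1951.vUnits_valuation_sub_one_le`
(`NumberFields/ChevalleyVUnitCongruenceProofs`; the composite `HT → hG` is
`frobSatakeCompatibleAt_of_isPiOfArtinRep_of_isUnramifiedAt_of_heckeTheoryGL2` of
`Automorphic/PiOfArtinRepHeckeTheoryOnlyProofs`).  This file records the resulting sharper closure of
the crux, with the displayed hypothesis `HT` (Jacquet–Langlands 1970, Thm. 11.1, Cor. 11.2, Thm. 2.18,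
Props. 3.5, 3.6, 3.8, with the unramified dictionary: for every cuspidal `π` on `GL₂(𝔸_F)` and every
continuous character `χ` of `Γ_F`, completed twisted `L`-functions of `π` and `π̃` with Euler products
of degree `≤ 2`, meromorphic continuation and functional equation, the unramified local factors,
triviality of the local factor under deep ramification of the twist, and "degree 2 ⟹ unramified")
written verbatim:

* `artinWeightRealisationLevel_of_artinWeightRealisation_of_heckeTheoryGL2 : R → HT → R′` — the crux
  BY NAME modulo item stmt-Langlands-11057 and `HT` (no other named fact: the cusp-form existence
  fact is the tree theorem `nonempty_cuspidalAutomorphicRepData_two_holds`, Chevalley's theorem is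
  `vUnits_valuation_sub_one_le`);
* `artinWeightRealisationLevel_iff_artinWeightRealisation_of_heckeTheoryGL2 : HT → (R′ ↔ R)` — the two
  cruxes stmt-Langlands-15111 / stmt-Langlands-11057 are equivalent modulo the twisted Hecke theory of
  `GL(2)` alone.

No definition and no named fact is introduced.
-/

noncomputable section

-- `Summit.Langlands.Langlands.…`: summit = sub-problem name (D-0017 nested layout), not a typo.
set_option linter.dupNamespace false

namespace Summit.Langlands.Langlands.Theorems.ArtinWeightRealisationLevel

open Literature.NumberTheory.Automorphic

/-- **R′ from R and the twisted Hecke theory of `GL(2)`.**  The crux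
`ParityBlindBianchi.ArtinWeightRealisationLevel` (stmt-Langlands-15111) BY NAME from the shared a.e.
crux `RuelleTorsionArtinWeight.ArtinWeightRealisation` (item stmt-Langlands-11057) and the displayed
hypothesis `HT` — Jacquet–Langlands' twisted Hecke theory of cuspidal automorphic representations of
`GL(2)` (Thm. 11.1, Cor. 11.2, Thm. 2.18, Props. 3.5, 3.6, 3.8, with the unramified dictionary),
verbatim the hypothesis of `frobSatakeCompatibleAt_of_isPiOfArtinRep_both_of_chevalley` /
`…_of_isUnramifiedAt_of_heckeTheoryGL2`.  Proof: Gelbart's Prop. 4.1 σ-shadow hG from `HT` and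
Chevalley's theorem (`vUnits_valuation_sub_one_le`), then
`artinWeightRealisationLevel_of_artinWeightRealisation_of_gelbart`.
[cite: JacquetLanglands1970, Thm. 11.1, Cor. 11.2, Lemma 12.5, proof of Thm. 12.2 pp. 209–211]
[cite: Gelbart1997, Prop. 4.1] -/
theorem artinWeightRealisationLevel_of_artinWeightRealisation_of_heckeTheoryGL2 : Summit.Langlands.Langlands.Theses.RuelleTorsionArtinWeight.ArtinWeightRealisation → (∀ {F : Type} [Field F] [NumberField F] (hcpt : Literature.NumberTheory.Automorphic.isCompact_glFiniteIntegralLevel 2 F) (π : Literature.NumberTheory.Automorphic.CuspidalAutomorphicRepData 2 F hcpt), ∃ Nπ : IsDedekindDomain.HeightOneSpectrum (NumberField.RingOfIntegers F) → ℕ, ∀ χ : Field.absoluteGaloisGroup F →ₜ* ℂˣ, ∃ (P P' : IsDedekindDomain.HeightOneSpectrum (NumberField.RingOfIntegers F) → Polynomial ℂ) (Λ Λ' Γ Γ' ε : ℂ → ℂ) (c : ℝ), (∀ u, (P u).eval 0 = 1 ∧ (P u).natDegree ≤ 2) ∧ (∀ u, (P' u).eval 0 = 1 ∧ (P' u).natDegree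 ≤ 2) ∧ Meromorphic Λ ∧ Meromorphic Λ' ∧ Differentiable ℂ Γ ∧ Differentiable ℂ Γ' ∧ (∃ Y : Set ℝ, Y.Finite ∧ ∀ s, Γ s = 0 → s.im ∈ Y) ∧ (∃ Y : Set ℝ, Y.Finite ∧ ∀ s, Γ' s = 0 → s.im ∈ Y) ∧ Continuous ε ∧ (∀ s, ε s ≠ 0) ∧ 1 ≤ c ∧ (∀ s : ℂ, c < s.re → (Multipliable fun u : IsDedekindDomain.HeightOneSpectrum (NumberField.RingOfIntegers F) => ((P u).eval ((u.residueCard : ℂ) ^ (-s)))⁻¹) ∧ (∀ u, (P u).eval ((u.residueCard : ℂ) ^ (-s)) ≠ 0) ∧ Λ s * Γ s = ∏' u : IsDedekindDomain.HeightOneSpectrum (NumberField.RingOfIntegers F), ((P u).eval ((u.residueCard : ℂ) ^ (-s)))⁻¹) ∧ (∀ s : ℂ, c < s.re → (Multipliable fun u : IsDedekindDomain.HeightOneSpectrum (NumberField.RingOfIntegers F) => ((P' u).eval ((u.residueCard : ℂ) ^ (-s)))⁻¹) ∧ (∀ u, (P' u).eval ((u.residueCard : ℂ) ^ (-s)) ≠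 0) ∧ Λ' s * Γ' s = ∏' u : IsDedekindDomain.HeightOneSpectrum (NumberField.RingOfIntegers F), ((P' u).eval ((u.residueCard : ℂ) ^ (-s)))⁻¹) ∧ (∀ s, Λ s = ε s * Λ' (1 - s)) ∧ (∀ (u : IsDedekindDomain.HeightOneSpectrum (NumberField.RingOfIntegers F)) (α : Multiset ℂ), π.1.HasSatakeParamAt u α → (∀ 𝔓 ∈ u.primesAbove, ∀ g ∈ 𝔓.inertia (Field.absoluteGaloisGroup F), χ g = 1) → ∀ 𝔓 ∈ u.primesAbove, ∀ g : Field.absoluteGaloisGroup F, IsArithFrobAt (NumberField.RingOfIntegers F) g 𝔓 → P u = Literature.NumberTheory.Automorphic.eulerPolynomial (α.map fun a => a * (χ g : ℂ)) ∧ P' u = Literature.NumberTheory.Automorphic.eulerPolynomial (α.map fun a => a⁻¹ * (χ g : ℂ)⁻¹)) ∧ (∀ (u : IsDedekindDomain.HeightOneSpectrum (NumberField.RingOfIntegers F)) (α : Multiset ℂ), π.1.HasSatakeParamAt u α → (∃ 𝔓 ∈ u.primesAbove, ∃ g ∈ 𝔓.inertia (Field.absoluteGaloisGroup F), χ g ≠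 1) → P u = 1 ∧ P' u = 1) ∧ (∀ u : IsDedekindDomain.HeightOneSpectrum (NumberField.RingOfIntegers F), (∀ 𝔓 ∈ u.primesAbove, ∃ g ∈ 𝔓.inertia (Field.absoluteGaloisGroup F), ∀ k : ℕ, 0 < k → k ≤ Nπ u → χ g ^ k ≠ 1) → P u = 1 ∧ P' u = 1) ∧ (∀ u : IsDedekindDomain.HeightOneSpectrum (NumberField.RingOfIntegers F), (∀ 𝔓 ∈ u.primesAbove, ∀ g ∈ 𝔓.inertia (Field.absoluteGaloisGroup F), χ g = 1) → (∀ 𝔓 ∈ u.primesAbove, ∀ g : Field.absoluteGaloisGroup F, IsArithFrobAt (NumberField.RingOfIntegers F) g 𝔓 → χ g = 1) → (P u).natDegree = 2 → ∃ B : Multiset ℂ, (0 : ℂ) ∉ B ∧ P u = Literature.NumberTheory.Automorphic.eulerPolynomial B ∧ π.1.HasSatakeParamAt u B)) → Summit.Langlands.Langlands.Theses.ParityBlindBianchi.ArtinWeightRealisationLevel :=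
  fun hR HT =>
    artinWeightRealisationLevel_of_artinWeightRealisation_of_gelbart hR
      (frobSatakeCompatibleAt_of_isPiOfArtinRep_both_of_chevalley
        (fun v w hwv S₀ m =>
          Literature.NumberTheory.NumberFields.Chevalley1951.vUnits_valuation_sub_one_le v w hwv S₀ m)
        (fun hcpt π => HT hcpt π)).2

/-- **The two cruxes are equivalent modulo the twisted Hecke theory of `GL(2)` alone.**  Under the
displayed hypothesis `HT` (Jacquet–Langlands 1970, Thm. 11.1, Cor. 11.2, Thm. 2.18, Props. 3.5, 3.6,
3.8), `ParityBlindBianchi.ArtinWeightRealisationLevel` (stmt-Langlands-15111, every good place) and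
`RuelleTorsionArtinWeight.ArtinWeightRealisation` (stmt-Langlands-11057, almost every place) are
equivalent: `←` is the previous theorem, `→` is unconditional
(`artinWeightRealisation_of_artinWeightRealisationLevel`).  Via
`artinWeightRealisationLevel_iff_artinWeightRealisation_of_gelbart`.
[cite: JacquetLanglands1970, Thm. 11.1, Cor. 11.2, proof of Thm. 12.2 pp. 209–211]
[cite: Gelbart1997, Prop. 4.1] -/
theorem artinWeightRealisationLevel_iff_artinWeightRealisation_of_heckeTheoryGL2 : (∀ {F : Type} [Field F] [NumberField F] (hcpt : Literature.NumberTheory.Automorphic.isCompact_glFiniteIntegralLevel 2 F) (π : Literature.NumberTheory.Automorphic.CuspidalAutomorphicRepData 2 F hcpt), ∃ Nπ : IsDedekindDomain.HeightOneSpectrum (NumberField.RingOfIntegers F) → ℕ, ∀ χ : Field.absoluteGaloisGroup F →ₜ* ℂˣ, ∃ (P P' : IsDedekindDomain.HeightOneSpectrum (NumberField.RingOfIntegers F) → Polynomial ℂ) (Λ Λ' Γ Γ' ε : ℂ → ℂ) (c : ℝ), (∀ u, (P u).eval 0 = 1 ∧ (P u).natDegree ≤ 2) ∧ (∀ u, (P'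 u).eval 0 = 1 ∧ (P' u).natDegree ≤ 2) ∧ Meromorphic Λ ∧ Meromorphic Λ' ∧ Differentiable ℂ Γ ∧ Differentiable ℂ Γ' ∧ (∃ Y : Set ℝ, Y.Finite ∧ ∀ s, Γ s = 0 → s.im ∈ Y) ∧ (∃ Y : Set ℝ, Y.Finite ∧ ∀ s, Γ' s = 0 → s.im ∈ Y) ∧ Continuous ε ∧ (∀ s, ε s ≠ 0) ∧ 1 ≤ c ∧ (∀ s : ℂ, c < s.re → (Multipliable fun u : IsDedekindDomain.HeightOneSpectrum (NumberField.RingOfIntegers F) => ((P u).eval ((u.residueCard : ℂ) ^ (-s)))⁻¹) ∧ (∀ u, (P u).eval ((u.residueCard : ℂ) ^ (-s)) ≠ 0) ∧ Λ s * Γ s = ∏' u : IsDedekindDomain.HeightOneSpectrum (NumberField.RingOfIntegers F), ((P u).eval ((u.residueCard : ℂ) ^ (-s)))⁻¹) ∧ (∀ s : ℂ, c < s.re → (Multipliable fun u : IsDedekindDomain.HeightOneSpectrum (NumberField.RingOfIntegers F) => ((P' u).eval ((u.residueCard : ℂ) ^ (-s)))⁻¹) ∧ (∀ u, (P' u).eval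 ((u.residueCard : ℂ) ^ (-s)) ≠ 0) ∧ Λ' s * Γ' s = ∏' u : IsDedekindDomain.HeightOneSpectrum (NumberField.RingOfIntegers F), ((P' u).eval ((u.residueCard : ℂ) ^ (-s)))⁻¹) ∧ (∀ s, Λ s = ε s * Λ' (1 - s)) ∧ (∀ (u : IsDedekindDomain.HeightOneSpectrum (NumberField.RingOfIntegers F)) (α : Multiset ℂ), π.1.HasSatakeParamAt u α → (∀ 𝔓 ∈ u.primesAbove, ∀ g ∈ 𝔓.inertia (Field.absoluteGaloisGroup F), χ g = 1) → ∀ 𝔓 ∈ u.primesAbove, ∀ g : Field.absoluteGaloisGroup F, IsArithFrobAt (NumberField.RingOfIntegers F) g 𝔓 → P u = Literature.NumberTheory.Automorphic.eulerPolynomial (α.map fun a => a * (χ g : ℂ)) ∧ P' u = Literature.NumberTheory.Automorphic.eulerPolynomial (α.map fun a => a⁻¹ * (χ g : ℂ)⁻¹)) ∧ (∀ (u : IsDedekindDomain.HeightOneSpectrum (NumberField.RingOfIntegers F)) (α : Multiset ℂ), π.1.HasSatakeParamAt u α → (∃ 𝔓 ∈ u.primesAbove, ∃ g ∈ 𝔓.inertia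 (Field.absoluteGaloisGroup F), χ g ≠ 1) → P u = 1 ∧ P' u = 1) ∧ (∀ u : IsDedekindDomain.HeightOneSpectrum (NumberField.RingOfIntegers F), (∀ 𝔓 ∈ u.primesAbove, ∃ g ∈ 𝔓.inertia (Field.absoluteGaloisGroup F), ∀ k : ℕ, 0 < k → k ≤ Nπ u → χ g ^ k ≠ 1) → P u = 1 ∧ P' u = 1) ∧ (∀ u : IsDedekindDomain.HeightOneSpectrum (NumberField.RingOfIntegers F), (∀ 𝔓 ∈ u.primesAbove, ∀ g ∈ 𝔓.inertia (Field.absoluteGaloisGroup F), χ g = 1) → (∀ 𝔓 ∈ u.primesAbove, ∀ g : Field.absoluteGaloisGroup F, IsArithFrobAt (NumberField.RingOfIntegers F) g 𝔓 → χ g = 1) → (P u).natDegree = 2 → ∃ B : Multiset ℂ, (0 : ℂ) ∉ B ∧ P u = Literature.NumberTheory.Automorphic.eulerPolynomial B ∧ π.1.HasSatakeParamAt u B)) → (Summit.Langlands.Langlands.Theses.ParityBlindBianchi.ArtinWeightRealisationLevel ↔ Summit.Langlands.Langlands.Theses.RuelleTorsionArtinWeight.ArtinWeightRealisation) :=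
  fun HT =>
    artinWeightRealisationLevel_iff_artinWeightRealisation_of_gelbart
      (frobSatakeCompatibleAt_of_isPiOfArtinRep_both_of_chevalley
        (fun v w hwv S₀ m =>
          Literature.NumberTheory.NumberFields.Chevalley1951.vUnits_valuation_sub_one_le v w hwv S₀ m)
        (fun hcpt π => HT hcpt π)).2

end Summit.Langlands.Langlands.Theorems.ArtinWeightRealisationLevel

end
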